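import Summits.NavierStokesRegularity.NavierStokesRegularity.Theorems.QuantisedSymmetryPolyhedralDssProfileExistsStubGaussianEnstrophyIdentityHelpers
import HarnessLib

/-!
# The Gaussian enstrophy identity of a periodic Leray orbit — crux stmt-NavierStokesRegularity-1404
  (`QuantisedSymmetry.PolyhedralDssProfileExists`), line polyhedral_cell, stub
  stub_gaussianEnstrophyIdentity (N10)

Registered stub `stub_gaussianEnstrophyIdentity` (`--supports stmt-NavierStokesRegularity-1404`).
Let `(U, P)` be a classical solution of the BACKWARD LERAY SYSTEM
`∂ₛU + ½U + ½(y·∇)U + (U·∇)U + ∇P = ΔU`, `div U = 0` on `ℝ × ℝ³` (`IsBackwardLeraySolutionOn univ 1`),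
`S`-periodic in `s`, with polynomial bounds on `U`, `DU`, `∂ₛU`, `P`, `∇P`. With the Gaussian
`w₀ = e^{−|y|²/4}` and the head pressure `Π̃ = P + ½|U|² + ½ y·U = headPressure ½ U P`:

  `∫₀^S ∫ w₀ |curl U|² dy ds = −½ ∫₀^S ∫ w₀ Π̃ (y·U) dy ds`.

Proof (Pineau–Vicol 2026, (5.4)/(7.7)–(7.10) with their adjoint weight replaced by `w₀`, for
which `L*w₀ = ½(y·U)w₀` is exactly the right-hand side; Tsai 1998, (1.7)): (i) pointwise, `w₀|curl U|² = −w₀(−ΔΠ̃ + DΠ̃[U + ½y]) − w₀⟪U + ½y, ∂ₛU⟫`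
(`gaussEnstrophy_norm_curl_sq_eq`, from `PineauVicol2026.bernoulli_identity_rdss` with `α = 0`);
(ii) at fixed `s`, `∫ w₀(−ΔΠ̃ + DΠ̃[U + ½y]) = −∫ Π̃ (Δw₀ + div(w₀(U + ½y))) = ½ ∫ w₀ Π̃ ⟪y, U⟫`
(`gaussEnstrophy_integral_weight_mul_drift`, `gaussEnstrophy_weight_kernel`), every integrand being
`O((1 + |y|)^{4N+4} w₀)` (`gaussEnstrophy_bounds`), whence the slice identity `gaussEnstrophy_slice`;
(iii) over a period the `∂ₛ`-term integrates to zero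
(`PineauVicol2026.intervalIntegral_integral_weight_mul_inner_deriv_eq_zero`, Fubini on
`(0, S] × ℝ³` by `gaussEnstrophy_integrable_prod_of_le`).
-/

noncomputable section

-- the summit namespace `…NavierStokesRegularity.NavierStokesRegularity…` is the tree convention (D-0017)
set_option linter.dupNamespace false

namespace Summit.NavierStokesRegularity.NavierStokesRegularity.Theorems.PolyhedralDssProfileExists.PolyhedralCell

open MeasureTheory Set Function Filter Topology
open Literature.Analysis Literature.Analysis.FluidPDE
open scoped InnerProductSpace RealInnerProductSpace Laplacian ContDiff

section Main

variable {U : ℝ → EuclideanSpace ℝ (Fin 3) → EuclideanSpace ℝ (Fin 3)}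
  {P : ℝ → EuclideanSpace ℝ (Fin 3) → ℝ} {K : ℝ} {N : ℕ}

/-! ### Polynomial × Gaussian bounds for the integrands -/

/-- **Composites.** From `1 ≤ A`, `|y|, |V(y)|, ‖DV(y)‖, |Q(y)|, |∇Q(y)| ≤ A`:
`|Π| ≤ 2A²`, `‖DΠ‖ ≤ 3A²` (`Π = headPressure ½ V Q`, `DΠ w = ⟪V, DV w⟫ + DQ w + ½(⟪w, V⟫ + ⟪y, DV w⟫)`),
`|V + ½y| ≤ 2A`, `|⟪y, V⟫| ≤ A²`, `|curl V|² ≤ ‖curlCLM‖² A²`. [folklore] -/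
theorem gaussEnstrophy_composites {V : EuclideanSpace ℝ (Fin 3) → EuclideanSpace ℝ (Fin 3)}
    {Q : EuclideanSpace ℝ (Fin 3) → ℝ} (hV : Differentiable ℝ V) (hQ : Differentiable ℝ Q)
    {y : EuclideanSpace ℝ (Fin 3)} {A : ℝ} (h1 : 1 ≤ A) (hy : ‖y‖ ≤ A) (hVy : ‖V y‖ ≤ A)
    (hDV : ‖fderiv ℝ V y‖ ≤ A) (hQy : |Q y| ≤ A) (hDQ : ‖gradient Q y‖ ≤ A) :
    |headPressure (1 / 2) V Q y| ≤ 2 * A ^ 2 ∧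
      ‖fderiv ℝ (headPressure (1 / 2) V Q) y‖ ≤ 3 * A ^ 2 ∧
      ‖V y + (1 / 2 : ℝ) • y‖ ≤ 2 * A ∧ |⟪y, V y⟫| ≤ A ^ 2 ∧
      ‖curl V y‖ ^ 2 ≤ ‖curlCLM‖ ^ 2 * A ^ 2 := by
  have hA0 : 0 ≤ A := zero_le_one.trans h1
  have hAA : A ≤ A ^ 2 := by nlinarith
  have hyV : |⟪y, V y⟫| ≤ A ^ 2 :=
    (abs_real_inner_le_norm _ _).trans (by rw [sq]; exact mul_le_mul hy hVy (norm_nonneg _) hA0)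
  have hV2 : ‖V y‖ ^ 2 ≤ A ^ 2 := pow_le_pow_left₀ (norm_nonneg _) hVy 2
  have hHd : |headPressure (1 / 2) V Q y| ≤ 2 * A ^ 2 := by
    rw [headPressure_apply]
    calc |2⁻¹ * ‖V y‖ ^ 2 + Q y + 1 / 2 * ⟪y, V y⟫|
        ≤ |2⁻¹ * ‖V y‖ ^ 2| + |Q y| + |1 / 2 * ⟪y, V y⟫| := abs_add_three _ _ _
      _ = 2⁻¹ * ‖V y‖ ^ 2 + |Q y| + 1 / 2 * |⟪y, V y⟫| := by
          rw [abs_of_nonneg (by positivity), abs_mul, abs_of_pos (by norm_num : (0 : ℝ) < 1 / 2)]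
      _ ≤ 2⁻¹ * A ^ 2 + A + 1 / 2 * A ^ 2 := by gcongr
      _ ≤ 2 * A ^ 2 := by nlinarith
  have hb : ‖V y + (1 / 2 : ℝ) • y‖ ≤ 2 * A := by
    calc ‖V y + (1 / 2 : ℝ) • y‖ ≤ ‖V y‖ + ‖(1 / 2 : ℝ) • y‖ := norm_add_le _ _
      _ = ‖V y‖ + 1 / 2 * ‖y‖ := by
          rw [norm_smul, Real.norm_eq_abs, abs_of_pos (by norm_num : (0 : ℝ) < 1 / 2)]
      _ ≤ A + 1 / 2 * A := by gcongr
      _ ≤ 2 * A := by linarith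
  have hDHd : ‖fderiv ℝ (headPressure (1 / 2) V Q) y‖ ≤ 3 * A ^ 2 := by
    refine ContinuousLinearMap.opNorm_le_bound _ (by positivity) fun v => ?_
    rw [fderiv_headPressure_apply hV hQ, Real.norm_eq_abs]
    have hDVv : ‖fderiv ℝ V y v‖ ≤ A * ‖v‖ :=
      (ContinuousLinearMap.le_opNorm _ _).trans (mul_le_mul_of_nonneg_right hDV (norm_nonneg _))
    have hDQ' : ‖fderiv ℝ Q y‖ ≤ A := by
      have e : ‖gradient Q y‖ = ‖fderiv ℝ Q y‖ := by rw [gradient, LinearIsometryEquiv.norm_map]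
      rwa [e] at hDQ
    have hDQv : |fderiv ℝ Q y v| ≤ A * ‖v‖ := by
      rw [← Real.norm_eq_abs]
      exact (ContinuousLinearMap.le_opNorm _ _).trans (mul_le_mul_of_nonneg_right hDQ' (norm_nonneg _))
    have t1 : |⟪V y, fderiv ℝ V y v⟫| ≤ A * (A * ‖v‖) :=
      (abs_real_inner_le_norm _ _).trans (mul_le_mul hVy hDVv (norm_nonneg _) hA0)
    have t3 : |⟪v, V y⟫| ≤ ‖v‖ * A :=
      (abs_real_inner_le_norm _ _).trans (mul_le_mul_of_nonneg_left hVy (norm_nonneg _))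
    have t4 : |⟪y, fderiv ℝ V y v⟫| ≤ A * (A * ‖v‖) :=
      (abs_real_inner_le_norm _ _).trans (mul_le_mul hy hDVv (norm_nonneg _) hA0)
    have hAv : A * ‖v‖ ≤ A ^ 2 * ‖v‖ := mul_le_mul_of_nonneg_right hAA (norm_nonneg v)
    calc |⟪V y, fderiv ℝ V y v⟫ + fderiv ℝ Q y v + 1 / 2 * (⟪v, V y⟫ + ⟪y, fderiv ℝ V y v⟫)|
        ≤ |⟪V y, fderiv ℝ V y v⟫| + |fderiv ℝ Q y v| +
            |1 / 2 * (⟪v, V y⟫ + ⟪y, fderiv ℝ V y v⟫)| := abs_add_three _ _ _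
      _ ≤ |⟪V y, fderiv ℝ V y v⟫| + |fderiv ℝ Q y v| +
            1 / 2 * (|⟪v, V y⟫| + |⟪y, fderiv ℝ V y v⟫|) := by
          rw [abs_mul, abs_of_pos (by norm_num : (0 : ℝ) < 1 / 2)]
          gcongr
          exact abs_add_le _ _
      _ ≤ A * (A * ‖v‖) + A * ‖v‖ + 1 / 2 * (‖v‖ * A + A * (A * ‖v‖)) := by gcongr
      _ ≤ 3 * A ^ 2 * ‖v‖ := by nlinarith [hAv]
  have hcurl : ‖curl V y‖ ^ 2 ≤ ‖curlCLM‖ ^ 2 * A ^ 2 := by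
    calc ‖curl V y‖ ^ 2 ≤ (‖curlCLM‖ * ‖fderiv ℝ V y‖) ^ 2 :=
          pow_le_pow_left₀ (norm_nonneg _) (norm_curl_le V y) 2
      _ = ‖curlCLM‖ ^ 2 * ‖fderiv ℝ V y‖ ^ 2 := by ring
      _ ≤ ‖curlCLM‖ ^ 2 * A ^ 2 :=
          mul_le_mul_of_nonneg_left (pow_le_pow_left₀ (norm_nonneg _) hDV 2) (by positivity)
  exact ⟨hHd, hDHd, hb, hyV, hcurl⟩

/-- **Pointwise bounds for every integrand of the identity** by the integrable majorant
`(1 + |y|)^{4(N+1)} e^{−|y|²/4}`: the enstrophy density `w₀|curl U|²`, the `∂ₛ`-term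
`w₀⟪U + ½y, ∂ₛU⟫`, the three boundary integrands `|w₀||∇Π|`, `|Π||∇w₀|`, `|Π||w₀||U + ½y|` of the
cut-off integration by parts, the source term `Π · (−½⟪y, U⟫w₀)`, and the right-hand side
`w₀ Π ⟪y, U⟫`. [folklore] -/
theorem gaussEnstrophy_bounds (h : IsBackwardLeraySolutionOn Set.univ 1 U P)
    (hK : ∀ s y, ‖U s y‖ ≤ K * (1 + ‖y‖) ^ N ∧ ‖fderiv ℝ (U s) y‖ ≤ K * (1 + ‖y‖) ^ N ∧
      ‖timeDeriv U s y‖ ≤ K * (1 + ‖y‖) ^ N ∧ |P s y| ≤ K * (1 + ‖y‖) ^ N ∧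
      ‖gradient (P s) y‖ ≤ K * (1 + ‖y‖) ^ N) (s : ℝ) (y : EuclideanSpace ℝ (Fin 3)) :
    |gaussProfile (-(1 / 4 : ℝ)) y * ‖curl (U s) y‖ ^ 2| ≤
        (‖curlCLM‖ ^ 2 * (|K| + 1) ^ 4) * ((1 + ‖y‖) ^ (4 * (N + 1)) * gaussProfile (-(1 / 4 : ℝ)) y) ∧
      |gaussProfile (-(1 / 4 : ℝ)) y * ⟪U s y + (1 / 2 : ℝ) • y, deriv (fun τ => U τ y) s⟫| ≤
        (2 * (|K| + 1) ^ 4) * ((1 + ‖y‖) ^ (4 * (N + 1)) * gaussProfile (-(1 / 4 : ℝ)) y) ∧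
      |(|gaussProfile (-(1 / 4 : ℝ)) y| * ‖gradient (headPressure (1 / 2) (U s) (P s)) y‖)| ≤
        (3 * (|K| + 1) ^ 4) * ((1 + ‖y‖) ^ (4 * (N + 1)) * gaussProfile (-(1 / 4 : ℝ)) y) ∧
      |(|headPressure (1 / 2) (U s) (P s) y| * ‖gradient (gaussProfile (E := EuclideanSpace ℝ (Fin 3)) (-(1 / 4 : ℝ))) y‖)| ≤
        (1 * (|K| + 1) ^ 4) * ((1 + ‖y‖) ^ (4 * (N + 1)) * gaussProfile (-(1 / 4 : ℝ)) y) ∧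
      |(|headPressure (1 / 2) (U s) (P s) y| * |gaussProfile (-(1 / 4 : ℝ)) y| * ‖U s y + (1 / 2 : ℝ) • y‖)| ≤
        (4 * (|K| + 1) ^ 4) * ((1 + ‖y‖) ^ (4 * (N + 1)) * gaussProfile (-(1 / 4 : ℝ)) y) ∧
      |headPressure (1 / 2) (U s) (P s) y * (-(1 / 2 : ℝ) * ⟪y, U s y⟫ * gaussProfile (-(1 / 4 : ℝ)) y)| ≤
        (1 * (|K| + 1) ^ 4) * ((1 + ‖y‖) ^ (4 * (N + 1)) * gaussProfile (-(1 / 4 : ℝ)) y) ∧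
      |gaussProfile (-(1 / 4 : ℝ)) y * ((P s y + ‖U s y‖ ^ 2 / 2 + ⟪y, U s y⟫ / 2) * ⟪y, U s y⟫)| ≤
        (2 * (|K| + 1) ^ 4) * ((1 + ‖y‖) ^ (4 * (N + 1)) * gaussProfile (-(1 / 4 : ℝ)) y) := by
  have hUd : Differentiable ℝ (U s) := (h.contDiff_velocity (mem_univ s)).differentiable (by simp)
  have hPd : Differentiable ℝ (P s) := (h.contDiff_pressure (mem_univ s)).differentiable (by simp)
  obtain ⟨h1, hy, hUy, hDU, hUt, hPy, hDP⟩ := gaussEnstrophy_atoms hK s y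
  obtain ⟨hHd, hDHd, hb, hyU, hcurl⟩ := gaussEnstrophy_composites hUd hPd h1 hy hUy hDU hPy hDP
  set A : ℝ := (|K| + 1) * (1 + ‖y‖) ^ (N + 1) with hA_def
  have hA0 : 0 ≤ A := zero_le_one.trans h1
  have hA24 : A ^ 2 ≤ A ^ 4 := pow_le_pow_right₀ h1 (by norm_num)
  have hA34 : A ^ 3 ≤ A ^ 4 := pow_le_pow_right₀ h1 (by norm_num)
  have hg0 : 0 < gaussProfile (-(1 / 4 : ℝ)) y := Real.exp_pos _
  have hM : ∀ c : ℝ, (c * (|K| + 1) ^ 4) * ((1 + ‖y‖) ^ (4 * (N + 1)) * gaussProfile (-(1 / 4 : ℝ)) y) = c * A ^ 4 * gaussProfile (-(1 / 4 : ℝ)) y := by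
    intro c
    rw [hA_def, mul_pow, mul_comm 4 (N + 1), pow_mul]
    ring
  rw [hM, hM, hM, hM, hM]
  have hHdabs : 0 ≤ |headPressure (1 / 2) (U s) (P s) y| := abs_nonneg _
  refine ⟨?_, ?_, ?_, ?_, ?_, ?_, ?_⟩
  · rw [abs_of_nonneg (by positivity)]
    calc gaussProfile (-(1 / 4 : ℝ)) y * ‖curl (U s) y‖ ^ 2 ≤ gaussProfile (-(1 / 4 : ℝ)) y * (‖curlCLM‖ ^ 2 * A ^ 2) :=
          mul_le_mul_of_nonneg_left hcurl hg0.le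
      _ ≤ gaussProfile (-(1 / 4 : ℝ)) y * (‖curlCLM‖ ^ 2 * A ^ 4) := by gcongr
      _ = ‖curlCLM‖ ^ 2 * A ^ 4 * gaussProfile (-(1 / 4 : ℝ)) y := by ring
  · rw [abs_mul, abs_of_pos hg0]
    have hin : |⟪U s y + (1 / 2 : ℝ) • y, deriv (fun τ => U τ y) s⟫| ≤ 2 * A ^ 2 :=
      calc |⟪U s y + (1 / 2 : ℝ) • y, deriv (fun τ => U τ y) s⟫|
          ≤ ‖U s y + (1 / 2 : ℝ) • y‖ * ‖deriv (fun τ => U τ y) s‖ := abs_real_inner_le_norm _ _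
        _ ≤ (2 * A) * A := mul_le_mul hb hUt (norm_nonneg _) (by positivity)
        _ = 2 * A ^ 2 := by ring
    calc gaussProfile (-(1 / 4 : ℝ)) y * |⟪U s y + (1 / 2 : ℝ) • y, deriv (fun τ => U τ y) s⟫| ≤ gaussProfile (-(1 / 4 : ℝ)) y * (2 * A ^ 2) :=
          mul_le_mul_of_nonneg_left hin hg0.le
      _ ≤ gaussProfile (-(1 / 4 : ℝ)) y * (2 * A ^ 4) := by gcongr
      _ = 2 * A ^ 4 * gaussProfile (-(1 / 4 : ℝ)) y := by ring
  · rw [abs_mul, abs_abs, abs_of_pos hg0, abs_of_nonneg (norm_nonneg _)]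
    have hgr : ‖gradient (headPressure (1 / 2) (U s) (P s)) y‖ ≤ 3 * A ^ 2 := by
      have e : ‖gradient (headPressure (1 / 2) (U s) (P s)) y‖ =
          ‖fderiv ℝ (headPressure (1 / 2) (U s) (P s)) y‖ := by
        rw [gradient, LinearIsometryEquiv.norm_map]
      rwa [e]
    calc gaussProfile (-(1 / 4 : ℝ)) y * ‖gradient (headPressure (1 / 2) (U s) (P s)) y‖ ≤ gaussProfile (-(1 / 4 : ℝ)) y * (3 * A ^ 2) :=
          mul_le_mul_of_nonneg_left hgr hg0.le
      _ ≤ gaussProfile (-(1 / 4 : ℝ)) y * (3 * A ^ 4) := by gcongr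
      _ = 3 * A ^ 4 * gaussProfile (-(1 / 4 : ℝ)) y := by ring
  · rw [abs_mul, abs_abs, abs_of_nonneg (norm_nonneg _)]
    have hgw := gaussEnstrophy_norm_gradient_weight_le (E := EuclideanSpace ℝ (Fin 3)) y
    calc |headPressure (1 / 2) (U s) (P s) y| * ‖gradient (gaussProfile (E := EuclideanSpace ℝ (Fin 3)) (-(1 / 4 : ℝ))) y‖
        ≤ (2 * A ^ 2) * (1 / 2 * ‖y‖ * gaussProfile (-(1 / 4 : ℝ)) y) := mul_le_mul hHd hgw (norm_nonneg _) (by positivity)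
      _ ≤ (2 * A ^ 2) * (1 / 2 * A * gaussProfile (-(1 / 4 : ℝ)) y) := by gcongr
      _ = A ^ 3 * gaussProfile (-(1 / 4 : ℝ)) y := by ring
      _ ≤ 1 * A ^ 4 * gaussProfile (-(1 / 4 : ℝ)) y := by
          rw [one_mul]; exact mul_le_mul_of_nonneg_right hA34 hg0.le
  · rw [abs_mul, abs_mul, abs_abs, abs_abs, abs_of_pos hg0, abs_of_nonneg (norm_nonneg _)]
    calc |headPressure (1 / 2) (U s) (P s) y| * gaussProfile (-(1 / 4 : ℝ)) y * ‖U s y + (1 / 2 : ℝ) • y‖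
        ≤ (2 * A ^ 2) * gaussProfile (-(1 / 4 : ℝ)) y * (2 * A) :=
          mul_le_mul (mul_le_mul_of_nonneg_right hHd hg0.le) hb (norm_nonneg _) (by positivity)
      _ = 4 * A ^ 3 * gaussProfile (-(1 / 4 : ℝ)) y := by ring
      _ ≤ 4 * A ^ 4 * gaussProfile (-(1 / 4 : ℝ)) y :=
          mul_le_mul_of_nonneg_right (mul_le_mul_of_nonneg_left hA34 (by norm_num)) hg0.le
  · rw [abs_mul, abs_mul, abs_mul, abs_of_pos hg0, abs_neg,
      abs_of_pos (by norm_num : (0 : ℝ) < 1 / 2)]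
    calc |headPressure (1 / 2) (U s) (P s) y| * (1 / 2 * |⟪y, U s y⟫| * gaussProfile (-(1 / 4 : ℝ)) y)
        ≤ (2 * A ^ 2) * (1 / 2 * A ^ 2 * gaussProfile (-(1 / 4 : ℝ)) y) := by
          refine mul_le_mul hHd ?_ (by positivity) (by positivity)
          exact mul_le_mul_of_nonneg_right (mul_le_mul_of_nonneg_left hyU (by norm_num)) hg0.le
      _ = 1 * A ^ 4 * gaussProfile (-(1 / 4 : ℝ)) y := by ring
  · have e : P s y + ‖U s y‖ ^ 2 / 2 + ⟪y, U s y⟫ / 2 = headPressure (1 / 2) (U s) (P s) y := by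
      rw [headPressure_apply]; ring
    rw [e, abs_mul, abs_mul, abs_of_pos hg0]
    calc gaussProfile (-(1 / 4 : ℝ)) y * (|headPressure (1 / 2) (U s) (P s) y| * |⟪y, U s y⟫|)
        ≤ gaussProfile (-(1 / 4 : ℝ)) y * ((2 * A ^ 2) * A ^ 2) :=
          mul_le_mul_of_nonneg_left (mul_le_mul hHd hyU (abs_nonneg _) (by positivity)) hg0.le
      _ = 2 * A ^ 4 * gaussProfile (-(1 / 4 : ℝ)) y := by ring

/-! ### The slice identity -/

/-- **The Gaussian enstrophy identity of one slice.** For a classical solution of the backward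
Leray system on `ℝ × ℝ³` with the polynomial bounds of the stub and every `s`,
`∫ w₀ |curl U(s)|² = −½ ∫ w₀ Π̃(s) ⟪y, U(s)⟫ − ∫ w₀ ⟪U(s) + ½y, ∂ₛU(s)⟫`,
`Π̃ = P + ½|U|² + ½ y·U`, `w₀ = e^{−|y|²/4}`: the pointwise Bernoulli identity
`w₀|curl U|² = −w₀(−ΔΠ̃ + DΠ̃[U + ½y]) − w₀⟪U + ½y, ∂ₛU⟫` integrated over `ℝ³`, the first term
by `gaussEnstrophy_integral_weight_mul_drift` with `Δw₀ + div(w₀(U + ½y)) = −½⟪y, U⟫w₀`.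
[cite: PineauVicol2026, (5.4) (p. 13) and the display after (7.9) (p. 26)] -/
theorem gaussEnstrophy_slice (h : IsBackwardLeraySolutionOn Set.univ 1 U P)
    (hK : ∀ s y, ‖U s y‖ ≤ K * (1 + ‖y‖) ^ N ∧ ‖fderiv ℝ (U s) y‖ ≤ K * (1 + ‖y‖) ^ N ∧
      ‖timeDeriv U s y‖ ≤ K * (1 + ‖y‖) ^ N ∧ |P s y| ≤ K * (1 + ‖y‖) ^ N ∧
      ‖gradient (P s) y‖ ≤ K * (1 + ‖y‖) ^ N) (s : ℝ) :
    ∫ y, gaussProfile (-(1 / 4 : ℝ)) y * ‖curl (U s) y‖ ^ 2 =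
      -(1 / 2 : ℝ) * (∫ y, gaussProfile (-(1 / 4 : ℝ)) y * ((P s y + ‖U s y‖ ^ 2 / 2 + ⟪y, U s y⟫ / 2) * ⟪y, U s y⟫)) -
        ∫ y, gaussProfile (-(1 / 4 : ℝ)) y * ⟪U s y + (1 / 2 : ℝ) • y, deriv (fun τ => U τ y) s⟫ := by
  -- regularity of the slice
  have hU : ContDiff ℝ ∞ (U s) := h.contDiff_velocity (mem_univ s)
  have hP : ContDiff ℝ ∞ (P s) := h.contDiff_pressure (mem_univ s)
  have hUt : ContDiff ℝ ∞ (fun y : EuclideanSpace ℝ (Fin 3) => deriv (fun τ => U τ y) s) :=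
    (h.smooth_velocity.isSmoothSpaceTimeOn_deriv isOpen_univ).contDiff_slice (mem_univ s)
  have hdiv : VectorCalculus.IsDivFree (U s) := h.divFree s (mem_univ s)
  have hU1 : ContDiff ℝ 1 (U s) := hU.of_le (by norm_cast)
  have hU2 : ContDiff ℝ 2 (U s) := hU.of_le (by norm_cast)
  have hP2 : ContDiff ℝ 2 (P s) := hP.of_le (by norm_cast)
  have hH2 : ContDiff ℝ 2 (headPressure (1 / 2) (U s) (P s)) := contDiff_headPressure hU2 hP2
  have hb1 : ContDiff ℝ 1 (fun y : EuclideanSpace ℝ (Fin 3) => U s y + (1 / 2 : ℝ) • y) :=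
    hU1.add (contDiff_id.const_smul _)
  have hg2 : ContDiff ℝ 2 (gaussProfile (E := EuclideanSpace ℝ (Fin 3)) (-(1 / 4 : ℝ))) := contDiff_gaussProfile _
  have hgc : Continuous (gaussProfile (E := EuclideanSpace ℝ (Fin 3)) (-(1 / 4 : ℝ))) := hg2.continuous
  have hHc : Continuous (headPressure (1 / 2) (U s) (P s)) := hH2.continuous
  -- continuity of the slice integrands
  have cΩ : Continuous fun y => gaussProfile (-(1 / 4 : ℝ)) y * ‖curl (U s) y‖ ^ 2 :=
    hgc.mul ((continuous_curl hU1).norm.pow 2)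
  have cT : Continuous fun y => gaussProfile (-(1 / 4 : ℝ)) y * ⟪U s y + (1 / 2 : ℝ) • y, deriv (fun τ => U τ y) s⟫ :=
    hgc.mul (hb1.continuous.inner hUt.continuous)
  have hgH : ContDiff ℝ 1 (gradient (headPressure (1 / 2) (U s) (P s))) := contDiff_gradient hH2
  have hgg : ContDiff ℝ 1 (gradient (gaussProfile (E := EuclideanSpace ℝ (Fin 3)) (-(1 / 4 : ℝ)))) := contDiff_gradient hg2
  have c₁ : Continuous fun y => |gaussProfile (-(1 / 4 : ℝ)) y| * ‖gradient (headPressure (1 / 2) (U s) (P s)) y‖ :=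
    hgc.abs.mul hgH.continuous.norm
  have c₂ : Continuous fun y => |headPressure (1 / 2) (U s) (P s) y| * ‖gradient (gaussProfile (E := EuclideanSpace ℝ (Fin 3)) (-(1 / 4 : ℝ))) y‖ :=
    hHc.abs.mul hgg.continuous.norm
  have c₃ : Continuous fun y =>
      |headPressure (1 / 2) (U s) (P s) y| * |gaussProfile (-(1 / 4 : ℝ)) y| * ‖U s y + (1 / 2 : ℝ) • y‖ :=
    (hHc.abs.mul hgc.abs).mul hb1.continuous.norm
  have cG : Continuous fun y =>
      headPressure (1 / 2) (U s) (P s) y * (-(1 / 2 : ℝ) * ⟪y, U s y⟫ * gaussProfile (-(1 / 4 : ℝ)) y) :=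
    hHc.mul ((continuous_const.mul (continuous_id'.inner hU.continuous)).mul hgc)
  have cR : Continuous fun y =>
      gaussProfile (-(1 / 4 : ℝ)) y * ((P s y + ‖U s y‖ ^ 2 / 2 + ⟪y, U s y⟫ / 2) * ⟪y, U s y⟫) :=
    hgc.mul (((hP.continuous.add ((hU.continuous.norm.pow 2).div_const _)).add
      ((continuous_id'.inner hU.continuous).div_const _)).mul (continuous_id'.inner hU.continuous))
  -- integrability from the pointwise bounds
  have iΩ : Integrable fun y => gaussProfile (-(1 / 4 : ℝ)) y * ‖curl (U s) y‖ ^ 2 :=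
    gaussEnstrophy_integrable_of_le cΩ fun y => (gaussEnstrophy_bounds h hK s y).1
  have iT : Integrable fun y => gaussProfile (-(1 / 4 : ℝ)) y * ⟪U s y + (1 / 2 : ℝ) • y, deriv (fun τ => U τ y) s⟫ :=
    gaussEnstrophy_integrable_of_le cT fun y => (gaussEnstrophy_bounds h hK s y).2.1
  have i₁ : Integrable fun y => |gaussProfile (-(1 / 4 : ℝ)) y| * ‖gradient (headPressure (1 / 2) (U s) (P s)) y‖ :=
    gaussEnstrophy_integrable_of_le c₁ fun y => (gaussEnstrophy_bounds h hK s y).2.2.1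
  have i₂ : Integrable fun y => |headPressure (1 / 2) (U s) (P s) y| * ‖gradient (gaussProfile (E := EuclideanSpace ℝ (Fin 3)) (-(1 / 4 : ℝ))) y‖ :=
    gaussEnstrophy_integrable_of_le c₂ fun y => (gaussEnstrophy_bounds h hK s y).2.2.2.1
  have i₃ : Integrable fun y =>
      |headPressure (1 / 2) (U s) (P s) y| * |gaussProfile (-(1 / 4 : ℝ)) y| * ‖U s y + (1 / 2 : ℝ) • y‖ :=
    gaussEnstrophy_integrable_of_le c₃ fun y => (gaussEnstrophy_bounds h hK s y).2.2.2.2.1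
  have iG : Integrable fun y =>
      headPressure (1 / 2) (U s) (P s) y * (-(1 / 2 : ℝ) * ⟪y, U s y⟫ * gaussProfile (-(1 / 4 : ℝ)) y) :=
    gaussEnstrophy_integrable_of_le cG fun y => (gaussEnstrophy_bounds h hK s y).2.2.2.2.2.1
  -- the pointwise Bernoulli identity times the weight
  have hpt : ∀ y, gaussProfile (-(1 / 4 : ℝ)) y * ‖curl (U s) y‖ ^ 2 =
      -(gaussProfile (-(1 / 4 : ℝ)) y * (-(Δ (headPressure (1 / 2) (U s) (P s))) y +
          fderiv ℝ (headPressure (1 / 2) (U s) (P s)) y (U s y + (1 / 2 : ℝ) • y))) -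
        gaussProfile (-(1 / 4 : ℝ)) y * ⟪U s y + (1 / 2 : ℝ) • y, deriv (fun τ => U τ y) s⟫ := fun y => by
    rw [gaussEnstrophy_norm_curl_sq_eq h s y]
    ring
  have hint : Integrable fun y => gaussProfile (-(1 / 4 : ℝ)) y * (-(Δ (headPressure (1 / 2) (U s) (P s))) y +
      fderiv ℝ (headPressure (1 / 2) (U s) (P s)) y (U s y + (1 / 2 : ℝ) • y)) := by
    have e : (fun y => gaussProfile (-(1 / 4 : ℝ)) y * (-(Δ (headPressure (1 / 2) (U s) (P s))) y +
        fderiv ℝ (headPressure (1 / 2) (U s) (P s)) y (U s y + (1 / 2 : ℝ) • y))) = fun y =>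
        -(gaussProfile (-(1 / 4 : ℝ)) y * ‖curl (U s) y‖ ^ 2) -
          gaussProfile (-(1 / 4 : ℝ)) y * ⟪U s y + (1 / 2 : ℝ) • y, deriv (fun τ => U τ y) s⟫ := by
      funext y
      rw [hpt y]
      ring
    rw [e]
    exact iΩ.neg.sub iT
  have hker : ∀ y, (Δ (gaussProfile (E := EuclideanSpace ℝ (Fin 3)) (-(1 / 4 : ℝ)))) y + VectorCalculus.divergence
      (fun z => gaussProfile (-(1 / 4 : ℝ)) z • (U s z + (1 / 2 : ℝ) • z)) y = -(1 / 2 : ℝ) * ⟪y, U s y⟫ * gaussProfile (-(1 / 4 : ℝ)) y :=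
    fun y => gaussEnstrophy_weight_kernel ((hU.differentiable (by simp)) y) (hdiv y)
  have hdrift := gaussEnstrophy_integral_weight_mul_drift hH2 hg2 hb1 hker hint iG i₁ i₂ i₃
  -- assemble
  have e1 : (fun y => gaussProfile (-(1 / 4 : ℝ)) y * ‖curl (U s) y‖ ^ 2) = fun y =>
      -(gaussProfile (-(1 / 4 : ℝ)) y * (-(Δ (headPressure (1 / 2) (U s) (P s))) y +
          fderiv ℝ (headPressure (1 / 2) (U s) (P s)) y (U s y + (1 / 2 : ℝ) • y))) -
        gaussProfile (-(1 / 4 : ℝ)) y * ⟪U s y + (1 / 2 : ℝ) • y, deriv (fun τ => U τ y) s⟫ := funext hpt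
  have e2 : (fun y => headPressure (1 / 2) (U s) (P s) y * (-(1 / 2 : ℝ) * ⟪y, U s y⟫ * gaussProfile (-(1 / 4 : ℝ)) y)) =
      fun y => -(1 / 2 : ℝ) *
        (gaussProfile (-(1 / 4 : ℝ)) y * ((P s y + ‖U s y‖ ^ 2 / 2 + ⟪y, U s y⟫ / 2) * ⟪y, U s y⟫)) := by
    funext y
    rw [headPressure_apply]
    ring
  rw [e1, integral_sub hint.fun_neg iT, integral_neg, hdrift, neg_neg, e2, integral_const_mul]

/-! ### The registered stub -/

/-- **Stub N10 — the Gaussian enstrophy identity of a periodic Leray orbit.** Let `(U, P)` be a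
classical solution of the backward Leray system `∂ₛU + ½U + ½(y·∇)U + (U·∇)U + ∇P = ΔU`,
`div U = 0` on `ℝ × ℝ³`, `S`-periodic in `s` (`S > 0`), with polynomial bounds on `U`, `DU`,
`∂ₛU`, `P`, `∇P`. Then, with `w₀(y) = e^{−|y|²/4}` and `Π̃ = P + ½|U|² + ½ y·U`,
`∫₀^S ∫ w₀ |curl U|² dy ds = −½ ∫₀^S ∫ w₀ Π̃ (y·U) dy ds` (the slice identity
`gaussEnstrophy_slice` integrated over `[0, S]`, the `∂ₛ`-term
`∫₀^S∫ w₀⟪U + ½y, ∂ₛU⟫ = ∫ w₀ [½|U|² + ½ y·U]₀^S = 0` dropping out by periodicity,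
`PineauVicol2026.intervalIntegral_integral_weight_mul_inner_deriv_eq_zero`).
[cite: PineauVicol2026, (5.4) and (7.7)–(7.10)] -/
theorem stub_gaussianEnstrophyIdentity :
    ∀ (U : ℝ → EuclideanSpace ℝ (Fin 3) → EuclideanSpace ℝ (Fin 3)) (P : ℝ → EuclideanSpace ℝ (Fin 3) → ℝ)
      (S : ℝ), 0 < S → IsBackwardLeraySolutionOn Set.univ 1 U P → Function.Periodic U S →
      (∃ K : ℝ, ∃ N : ℕ, ∀ s y,
          ‖U s y‖ ≤ K * (1 + ‖y‖) ^ N ∧ ‖fderiv ℝ (U s) y‖ ≤ K * (1 + ‖y‖) ^ N ∧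
          ‖timeDeriv U s y‖ ≤ K * (1 + ‖y‖) ^ N ∧ |P s y| ≤ K * (1 + ‖y‖) ^ N ∧
          ‖gradient (P s) y‖ ≤ K * (1 + ‖y‖) ^ N) →
      ∫ s in (0 : ℝ)..S, ∫ y, Real.exp (-‖y‖ ^ 2 / 4) * ‖curl (U s) y‖ ^ 2 =
        -(1 / 2 : ℝ) * ∫ s in (0 : ℝ)..S, ∫ y, Real.exp (-‖y‖ ^ 2 / 4) *
          ((P s y + ‖U s y‖ ^ 2 / 2 + ⟪y, U s y⟫_ℝ / 2) * ⟪y, U s y⟫_ℝ) := by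
  intro U P S hS h hper hbd
  obtain ⟨K, N, hK⟩ := hbd
  -- the weight is the tree's `gaussProfile (−1/4)`
  have hw0 : ∀ y : EuclideanSpace ℝ (Fin 3), Real.exp (-‖y‖ ^ 2 / 4) = gaussProfile (-(1 / 4 : ℝ)) y := fun y => by
    simp only [gaussProfile]
    congr 1
    ring
  simp only [hw0]
  -- joint continuity of `U`, `P`, `∂ₛU`
  have hUst : IsSmoothSpaceTimeOn univ U := h.smooth_velocity
  have hUc : Continuous fun p : ℝ × EuclideanSpace ℝ (Fin 3) => U p.1 p.2 := by
    have h' := h.smooth_velocity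
    rw [IsSmoothSpaceTimeOn, univ_prod_univ, contDiffOn_univ] at h'
    exact h'.continuous
  have hPc : Continuous fun p : ℝ × EuclideanSpace ℝ (Fin 3) => P p.1 p.2 := by
    have h' := h.smooth_pressure
    rw [IsSmoothSpaceTimeOn, univ_prod_univ, contDiffOn_univ] at h'
    exact h'.continuous
  have hUtc : Continuous fun p : ℝ × EuclideanSpace ℝ (Fin 3) =>
      deriv (fun τ => U τ p.2) p.1 := by
    have h' := hUst.isSmoothSpaceTimeOn_deriv isOpen_univ
    rw [IsSmoothSpaceTimeOn, univ_prod_univ, contDiffOn_univ] at h'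
    exact h'.continuous
  have hgc : Continuous (gaussProfile (E := EuclideanSpace ℝ (Fin 3)) (-(1 / 4 : ℝ))) := (contDiff_gaussProfile (E := EuclideanSpace ℝ (Fin 3))
    (-(1 / 4 : ℝ)) (n := 0)).continuous
  -- the two space–time integrands are integrable on `(0, S] × ℝ³`
  have hbc : Continuous fun p : ℝ × EuclideanSpace ℝ (Fin 3) => U p.1 p.2 + (1 / 2 : ℝ) • p.2 :=
    hUc.add (continuous_snd.const_smul (1 / 2 : ℝ))
  have hcT : Continuous fun p : ℝ × EuclideanSpace ℝ (Fin 3) =>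
      gaussProfile (-(1 / 4 : ℝ)) p.2 * ⟪U p.1 p.2 + (1 / 2 : ℝ) • p.2, deriv (fun τ => U τ p.2) p.1⟫ :=
    (hgc.comp continuous_snd).mul (hbc.inner hUtc)
  have hcR : Continuous fun p : ℝ × EuclideanSpace ℝ (Fin 3) =>
      gaussProfile (-(1 / 4 : ℝ)) p.2 * ((P p.1 p.2 + ‖U p.1 p.2‖ ^ 2 / 2 + ⟪p.2, U p.1 p.2⟫ / 2) * ⟪p.2, U p.1 p.2⟫) :=
    (hgc.comp continuous_snd).mul (((hPc.add ((hUc.norm.pow 2).div_const _)).add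
      ((continuous_snd.inner hUc).div_const _)).mul (continuous_snd.inner hUc))
  have hIT : Integrable (fun p : ℝ × EuclideanSpace ℝ (Fin 3) =>
      gaussProfile (-(1 / 4 : ℝ)) p.2 * ⟪U p.1 p.2 + (1 / 2 : ℝ) • p.2, deriv (fun τ => U τ p.2) p.1⟫)
      ((volume.restrict (Ioc 0 S)).prod volume) :=
    gaussEnstrophy_integrable_prod_of_le hcT S fun p => (gaussEnstrophy_bounds h hK p.1 p.2).2.1
  have hIR : Integrable (fun p : ℝ × EuclideanSpace ℝ (Fin 3) =>
      gaussProfile (-(1 / 4 : ℝ)) p.2 * ((P p.1 p.2 + ‖U p.1 p.2‖ ^ 2 / 2 + ⟪p.2, U p.1 p.2⟫ / 2) * ⟪p.2, U p.1 p.2⟫))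
      ((volume.restrict (Ioc 0 S)).prod volume) :=
    gaussEnstrophy_integrable_prod_of_le hcR S fun p =>
      (gaussEnstrophy_bounds h hK p.1 p.2).2.2.2.2.2.2
  have hiT : IntervalIntegrable (fun s => ∫ y,
      gaussProfile (-(1 / 4 : ℝ)) y * ⟪U s y + (1 / 2 : ℝ) • y, deriv (fun τ => U τ y) s⟫) volume 0 S :=
    (intervalIntegrable_iff_integrableOn_Ioc_of_le hS.le).2 hIT.integral_prod_left
  have hiR : IntervalIntegrable (fun s => ∫ y,
      gaussProfile (-(1 / 4 : ℝ)) y * ((P s y + ‖U s y‖ ^ 2 / 2 + ⟪y, U s y⟫ / 2) * ⟪y, U s y⟫)) volume 0 S :=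
    (intervalIntegrable_iff_integrableOn_Ioc_of_le hS.le).2 hIR.integral_prod_left
  -- the `∂ₛ`-term drops out over a period
  have hT0 : ∫ s in (0 : ℝ)..S, ∫ y,
      gaussProfile (-(1 / 4 : ℝ)) y * ⟪U s y + (1 / 2 : ℝ) • y, deriv (fun τ => U τ y) s⟫ = 0 :=
    PineauVicol2026.intervalIntegral_integral_weight_mul_inner_deriv_eq_zero
      (U := fun y s => U s y) (Us := fun y s => deriv (fun τ => U τ y) s) hS.le _
      (fun y s => hUst.hasDerivAt_timeLine isOpen_univ (mem_univ s) y)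
      (fun y => hUtc.comp (continuous_id.prodMk continuous_const))
      (fun y => hUc.comp (continuous_id.prodMk continuous_const))
      (fun y => by simpa using congrFun (hper 0) y) hIT
  -- integrate the slice identity over `[0, S]`
  rw [intervalIntegral.integral_congr fun s _ => gaussEnstrophy_slice h hK s,
    intervalIntegral.integral_sub (hiR.const_mul _) hiT, hT0, sub_zero,
    intervalIntegral.integral_const_mul]

end Main

end Summit.NavierStokesRegularity.NavierStokesRegularity.Theorems.PolyhedralDssProfileExists.PolyhedralCell

end
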